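import Summits.QuantumFields.YangMills.Theorems.FluctuationComparisonRegPrIntLS2BetaSU2FourFactorExpansion
import Summits.QuantumFields.YangMills.Theorems.FluctuationComparisonRegPrIntLS2BetaWhitneyHatLiftRelative
import HarnessLib

/-!
# S2β · strata residue (H′) = {(D), (F)} of GAP♯∘ — THE RELATIVE FOUR-FACTOR EXPANSION IN THE QUATERNION CHART:
# `‖plaq4 v − plaq4 ṽ − ι·d(v − ṽ)‖ ≤ 4·(τ + τ̃)·Σ_i ‖v_i − ṽ_i‖` — the second-order remainder of a plaquette is SIZE-Lipschitz (the commutator-defect letter (C1)-cov, chart half)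

Cell `ym3-torus` (rung R3 = continuum `SU(2)` Yang–Mills on the three-torus — NOT d = 4, NOT infinite volume, NOT a mass gap, NOT Clay).
Width seat «width 12» `ym3-torus-px12` (gen 23), FREE px helper on crux `stmt-QuantumFields-20520` (`Theses.UnitScaleTilt.FluctuationComparisonRegPrIntL`),
count-neutral, DEFINITION-FREE.

WHAT IT IS FOR.  px16 g20's ✓`…S2BetaStrataOfLetters` reduces the registered GAP♯∘ to the letters (D) «relative telescoped road» and (F); the lift half of (D)
compares TWO towers level by level.  ✓p820752 `…WhitneyHatLiftRelative` gave the relative (R1) with constant exactly `(L⁻¹)²·L^d`; the companion the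
recursion needs is the RELATIVE CURVATURE of two lifts — (F3) of ✓`…WhitneyHatLiftCurvatureSq` for a PAIR — whose chart-level input is typed here: for two
quadruples of exponents `v = (a,b,c,d)`, `ṽ = (ã,b̃,c̃,d̃)` with sizes `≤ τ`, `≤ τ̃` (`τ, τ̃ ≤ 1∕4`), the two plaquette words `plaq4 v = e^a e^b e^{−c} e^{−d}` differ
by the LINEARISED CURL OF THE DIFFERENCE `ι·((a − ã) + (b − b̃) − (c − c̃) − (d − d̃))` up to a remainder that is SIZE × DIFFERENCE:
`≤ 4·(τ + τ̃)·(‖a − ã‖ + ‖b − b̃‖ + ‖c − c̃‖ + ‖d − d̃‖)` — so the relative plaquette `E = (plaq4 ṽ)⁻¹·plaq4 v` has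
`dist1 E ≤ ‖d(v − ṽ)‖ + 4(τ + τ̃)·Σδ` and conversely.  With `τ, τ̃` the (summable, geometric) sup sizes of the two coarse levels this is exactly the
`ε_t`-shape px16 g20's (D)-door asks for (UV3-NODE §71.3 (b) ∕ §75).
* §1 real-variable lemmas: `sq_cos_sub_cos_le` (`(cos a − cos b)² ≤ (a+b)²(a−b)²∕4`), `sub_sin_sub_le` (`0 ≤ (a − sin a) − (b − sin b) ≤ (a+b)²(a−b)∕6` on
  `0 ≤ b ≤ a ≤ 1`), `abs_sub_sin_sub_le`.
* §2 ★★`norm_expRem_sub_expRem_le` — **THE SECOND-ORDER REMAINDER `exp(ιv) − ιv` IS SIZE-LIPSCHITZ**: `‖(exp(ιv) − ιv) − (exp(ιw) − ιw)‖ ≤ (‖v‖ + ‖w‖)·‖v − w‖`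
  on the unit ball (numerically the sharp constant is `½`; exact computation of the square, affine in `⟪v,w⟫`).
* §3 ★`norm_mul_sub_mul_sub_add_le` (two factors, relative, any normed ring), `norm_mul_le_one_and`, `expFactor_rel` (one exponential factor against another),
  ★★`norm_plaq4_sub_plaq4_sub_le` (the displayed relative expansion), `dist1_inv_mul_eq_norm_sub`, ★★`dist1_plaq4_rel_le` ∕ `norm_lincurl_sub_le_dist1_rel_add` (the relative plaquette
  `E := (plaq4 ṽ)⁻¹ * plaq4 v` to first order in the difference, both directions), `dist1_plaq4_rel_le_sum` (zeroth order, no smallness: `dist1 E ≤ Σδ`).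

HONEST SCOPE.  Inequalities in the quaternion chart; nothing of Bałaban's analysis is asserted ([Balaban1985Variational] (34) p.283 is the printed locus of the plaquette
expansion about a background); (D), (F), `hIrr`, `hA`, TUBE-REG∘, GAP♯∘ (`stub_uniformFibreGapOrbit`), S2β, crux 20520 and `YM3TorusSU2` are NOT proved; no registered
stub is closed; the Yang–Mills mass gap is NOT proved.
-/

set_option autoImplicit false

noncomputable section

namespace Summit.QuantumFields.YangMills.Theorems.FluctuationComparisonRegPrIntLS2BetaSU2FourFactorRelative

open scoped Real Quaternion
open NormedSpace
open Literature.MathematicalPhysics.QuantumLattice (su2Quat norm_su2Quat)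
open Literature.MathematicalPhysics.QuantumFieldTheory.Balaban1983to89
open T4CubeChartGnomonic (SU2)
open T4HaarSU2ExpChart (imQuat imQuat_apply norm_imQuat exp_imQuat exp_imQuat_re norm_exp_imQuat expPoint su2Quat_expPoint)
open T4HaarSU2Translate (su2Quat_mul su2Quat_one)
open T4ExpWindowSmallField (logVec norm_logVec imVec norm_imVec_sq dist1_eq_norm_su2Quat_sub_one)
open B15Prop1ChartRecentering (imVec_exp_imQuat)
open Summit.QuantumFields.YangMills.Theorems.FluctuationComparisonRegPrIntLS2BetaSU2FourFactorExpansion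
  (norm_exp_imQuat_sub_one_le)
open Summit.QuantumFields.YangMills.Theorems.FluctuationComparisonRegPrIntLS2BetaWhitneyHatLiftRelative
  (mul_sinc_eq_sin norm_exp_imQuat_sub_exp_imQuat_le_norm_sub)

/-! ## §1 Three real-variable lemmas -/

/-- `(cos a − cos b)² ≤ (a+b)²(a−b)²∕4` (`cos a − cos b = −2 sin((a+b)∕2) sin((a−b)∕2)` and `|sin x| ≤ |x|`). [folklore] -/
theorem sq_cos_sub_cos_le (a b : ℝ) : (Real.cos a - Real.cos b) ^ 2 ≤ (a + b) ^ 2 * (a - b) ^ 2 / 4 := by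
  rw [Real.cos_sub_cos]
  have h1 : Real.sin ((a + b) / 2) ^ 2 ≤ ((a + b) / 2) ^ 2 := Real.sin_sq_le_sq
  have h2 : Real.sin ((a - b) / 2) ^ 2 ≤ ((a - b) / 2) ^ 2 := Real.sin_sq_le_sq
  calc (-2 * Real.sin ((a + b) / 2) * Real.sin ((a - b) / 2)) ^ 2
      = 4 * (Real.sin ((a + b) / 2) ^ 2 * Real.sin ((a - b) / 2) ^ 2) := by ring
    _ ≤ 4 * (((a + b) / 2) ^ 2 * ((a - b) / 2) ^ 2) :=
        mul_le_mul_of_nonneg_left (mul_le_mul h1 h2 (sq_nonneg _) (sq_nonneg _)) (by norm_num)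
    _ = (a + b) ^ 2 * (a - b) ^ 2 / 4 := by ring

/-- On `0 ≤ b ≤ a ≤ 1`: `0 ≤ (a − sin a) − (b − sin b) ≤ (a+b)²(a−b)∕6`
(`sin a − sin b = 2 sin((a−b)∕2) cos((a+b)∕2)`, `x − x³∕6 ≤ sin x ≤ x`, `1 − cos m ≤ m²∕2`). [folklore] -/
theorem sub_sin_sub_le {a b : ℝ} (hb0 : 0 ≤ b) (hba : b ≤ a) (ha1 : a ≤ 1) :
    0 ≤ (a - Real.sin a) - (b - Real.sin b) ∧ (a - Real.sin a) - (b - Real.sin b) ≤ (a + b) ^ 2 * (a - b) / 6 := by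
  have hδ0 : 0 ≤ a - b := sub_nonneg.mpr hba
  have hx0 : 0 ≤ (a - b) / 2 := by linarith
  have hsinx : Real.sin ((a - b) / 2) ≤ (a - b) / 2 := Real.sin_le hx0
  have hsinx0 : 0 ≤ Real.sin ((a - b) / 2) :=
    Real.sin_nonneg_of_nonneg_of_le_pi hx0 (by linarith [Real.pi_gt_three])
  have hcos1 : Real.cos ((a + b) / 2) ≤ 1 := Real.cos_le_one _
  have hcosm : 1 - ((a + b) / 2) ^ 2 / 2 ≤ Real.cos ((a + b) / 2) := Real.one_sub_sq_div_two_le_cos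
  have hT : (a - Real.sin a) - (b - Real.sin b) = (a - b) - 2 * Real.sin ((a - b) / 2) * Real.cos ((a + b) / 2) := by
    rw [show (a - Real.sin a) - (b - Real.sin b) = (a - b) - (Real.sin a - Real.sin b) by ring, Real.sin_sub_sin]
  rw [hT]
  constructor
  · nlinarith [mul_le_mul_of_nonneg_left hcos1 hsinx0]
  · -- `(a − b) − 2 sin x ≤ (a−b)³∕24` and `2 sin x (1 − cos m) ≤ (a − b)·(a+b)²∕8`
    have hcube : (a - b) - 2 * Real.sin ((a - b) / 2) ≤ (a - b) ^ 3 / 24 := by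
      rcases hx0.eq_or_lt with hx | hx
      · have : a - b = 0 := by linarith
        rw [this]; simp
      · have := Real.sin_gt_sub_cube hx
        nlinarith
    have hsecond : 2 * Real.sin ((a - b) / 2) * (1 - Real.cos ((a + b) / 2)) ≤ (a - b) * ((a + b) ^ 2 / 8) := by
      have h1c : 1 - Real.cos ((a + b) / 2) ≤ (a + b) ^ 2 / 8 := by nlinarith
      have h1c0 : 0 ≤ 1 - Real.cos ((a + b) / 2) := by linarith
      calc 2 * Real.sin ((a - b) / 2) * (1 - Real.cos ((a + b) / 2))
          ≤ (a - b) * (1 - Real.cos ((a + b) / 2)) := by nlinarith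
        _ ≤ (a - b) * ((a + b) ^ 2 / 8) := mul_le_mul_of_nonneg_left h1c hδ0
    have hδab : (a - b) ^ 3 ≤ (a + b) ^ 2 * (a - b) := by
      have : (a - b) ^ 2 ≤ (a + b) ^ 2 := by nlinarith
      nlinarith
    have hsplit : (a - b) - 2 * Real.sin ((a - b) / 2) * Real.cos ((a + b) / 2)
        = ((a - b) - 2 * Real.sin ((a - b) / 2)) + 2 * Real.sin ((a - b) / 2) * (1 - Real.cos ((a + b) / 2)) := by ring
    rw [hsplit]
    nlinarith

/-- Symmetric form on the unit interval: `|(a − sin a) − (b − sin b)| ≤ (a+b)²·|a − b|∕6`. [folklore] -/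
theorem abs_sub_sin_sub_le {a b : ℝ} (ha0 : 0 ≤ a) (ha1 : a ≤ 1) (hb0 : 0 ≤ b) (hb1 : b ≤ 1) :
    |(a - Real.sin a) - (b - Real.sin b)| ≤ (a + b) ^ 2 * |a - b| / 6 := by
  rcases le_total b a with hba | hab
  · obtain ⟨h0, h1⟩ := sub_sin_sub_le hb0 hba ha1
    rw [abs_of_nonneg h0, abs_of_nonneg (sub_nonneg.mpr hba)]
    exact h1
  · obtain ⟨h0, h1⟩ := sub_sin_sub_le ha0 hab hb1
    rw [abs_sub_comm, abs_of_nonneg h0, abs_sub_comm, abs_of_nonneg (sub_nonneg.mpr hab), add_comm]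
    exact h1

/-! ## §2 The second-order remainder of the exponential chart is size-Lipschitz -/

/-- ★★ **`‖(exp(ιv) − ιv) − (exp(ιw) − ιw)‖ ≤ (‖v‖ + ‖w‖)·‖v − w‖`** for `‖v‖, ‖w‖ ≤ 1`.  Exact computation: with `a = ‖v‖`, `b = ‖w‖`, `t = ⟪v,w⟫`,
`α = 1 − sinc a`, `β = 1 − sinc b`, the square of the left side is `(cos a − cos b)² + (αa − βb)² + 2αβ(ab − t)` and the square of the right side is
`(a+b)²(a−b)² + 2(a+b)²(ab − t)`; `αβ ≤ (a+b)²`, and at `t = ab` §1 gives `(cos a − cos b)² + ((a − sin a) − (b − sin b))² ≤ (1∕4 + 1∕9)(a+b)²(a−b)²`. [folklore] -/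
theorem norm_expRem_sub_expRem_le {v w : EuclideanSpace ℝ (Fin 3)} (hv : ‖v‖ ≤ 1) (hw : ‖w‖ ≤ 1) :
    ‖(exp (imQuat v) - imQuat v) - (exp (imQuat w) - imQuat w)‖ ≤ (‖v‖ + ‖w‖) * ‖v - w‖ := by
  have norm_sq_eq_re_sq_add : ∀ q : ℍ, ‖q‖ ^ 2 = q.re ^ 2 + ‖imVec q‖ ^ 2 := fun q => by
    rw [norm_imVec_sq, sq, ← Quaternion.normSq_eq_norm_mul_self, Quaternion.normSq_def']
    ring
  have imVec_sub : ∀ p q : ℍ, imVec (p - q) = imVec p - imVec q := fun p q => by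
    ext i; fin_cases i <;> simp [imVec]
  have imVec_imQuat : ∀ u : EuclideanSpace ℝ (Fin 3), imVec (imQuat u) = u := fun u => by
    ext i; fin_cases i <;> simp [imVec, imQuat_apply]
  set a := ‖v‖ with ha
  set b := ‖w‖ with hb
  have ha0 : 0 ≤ a := norm_nonneg _
  have hb0 : 0 ≤ b := norm_nonneg _
  -- the size letters `α = 1 − sinc a`, `β = 1 − sinc b`: `0 ≤ α ≤ a²∕6`, `0 ≤ β ≤ b²∕6`, `αa = a − sin a`
  set α := 1 - Real.sinc a with hαdef
  set β := 1 - Real.sinc b with hβdef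
  have hα0 : 0 ≤ α := sub_nonneg.mpr (Real.sinc_le_one a)
  have hβ0 : 0 ≤ β := sub_nonneg.mpr (Real.sinc_le_one b)
  have hαa : α * a = a - Real.sin a := by rw [hαdef, sub_mul, one_mul, mul_comm, mul_sinc_eq_sin]
  have hβb : β * b = b - Real.sin b := by rw [hβdef, sub_mul, one_mul, mul_comm, mul_sinc_eq_sin]
  have hαle : α ≤ a ^ 2 / 6 := by
    rcases ha0.eq_or_lt with h | h
    · rw [hαdef, ← h, Real.sinc_zero]; norm_num
    · have h1 : α * a ≤ a ^ 2 / 6 * a := by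
        rw [hαa, show a ^ 2 / 6 * a = a ^ 3 / 6 by ring]
        linarith [Real.sin_gt_sub_cube h]
      exact le_of_mul_le_mul_right h1 h
  have hβle : β ≤ b ^ 2 / 6 := by
    rcases hb0.eq_or_lt with h | h
    · rw [hβdef, ← h, Real.sinc_zero]; norm_num
    · have h1 : β * b ≤ b ^ 2 / 6 * b := by
        rw [hβb, show b ^ 2 / 6 * b = b ^ 3 / 6 by ring]
        linarith [Real.sin_gt_sub_cube h]
      exact le_of_mul_le_mul_right h1 h
  have hab1 : a * b ≤ 1 := mul_le_one₀ hv hb0 hw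
  have hab0 : 0 ≤ a * b := mul_nonneg ha0 hb0
  have hαβ : α * β ≤ (a + b) ^ 2 := by
    have h1 : α * β ≤ a ^ 2 / 6 * (b ^ 2 / 6) := mul_le_mul hαle hβle hβ0 (by positivity)
    have h2 : a ^ 2 / 6 * (b ^ 2 / 6) = (a * b) * (a * b) / 36 := by ring
    have h3 : (a * b) * (a * b) ≤ a * b := by
      have := mul_le_mul_of_nonneg_left hab1 hab0
      linarith [this]
    have h4 : a * b ≤ (a + b) ^ 2 := by
      rw [add_sq]
      nlinarith [sq_nonneg a, sq_nonneg b]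
    rw [h2] at h1
    linarith
  -- the exact squares
  have ht : inner ℝ v w ≤ a * b := real_inner_le_norm v w
  have hD : ‖(exp (imQuat v) - imQuat v) - (exp (imQuat w) - imQuat w)‖ ^ 2
      = (Real.cos a - Real.cos b) ^ 2 + (α * a - β * b) ^ 2 + 2 * (α * β) * (a * b - inner ℝ v w) := by
    rw [norm_sq_eq_re_sq_add]
    have hre : ((exp (imQuat v) - imQuat v) - (exp (imQuat w) - imQuat w)).re = Real.cos a - Real.cos b := by
      rw [Quaternion.re_sub, Quaternion.re_sub, Quaternion.re_sub, exp_imQuat_re, exp_imQuat_re, T4HaarSU2ExpChart.imQuat_re,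
        T4HaarSU2ExpChart.imQuat_re, sub_zero, sub_zero]
    have him : imVec ((exp (imQuat v) - imQuat v) - (exp (imQuat w) - imQuat w)) = (-α) • v - (-β) • w := by
      rw [imVec_sub, imVec_sub, imVec_sub, imVec_exp_imQuat, imVec_exp_imQuat, imVec_imQuat, imVec_imQuat, ← ha, ← hb,
        hαdef, hβdef, neg_sub, neg_sub, sub_smul, sub_smul, one_smul, one_smul]
    rw [hre, him, norm_sub_sq_real, norm_smul, norm_smul, real_inner_smul_left, real_inner_smul_right, Real.norm_eq_abs,
      Real.norm_eq_abs, abs_neg, abs_neg, abs_of_nonneg hα0, abs_of_nonneg hβ0, ← ha, ← hb]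
    ring
  have hR : ((a + b) * ‖v - w‖) ^ 2 = (a + b) ^ 2 * (a - b) ^ 2 + 2 * (a + b) ^ 2 * (a * b - inner ℝ v w) := by
    rw [mul_pow, norm_sub_sq_real, ← ha, ← hb]; ring
  -- the endpoint `t = ab`: §1
  have hcos : (Real.cos a - Real.cos b) ^ 2 ≤ (a + b) ^ 2 * (a - b) ^ 2 / 4 := sq_cos_sub_cos_le a b
  have hsin : (α * a - β * b) ^ 2 ≤ (a + b) ^ 2 * (a - b) ^ 2 / 9 := by
    have h1 : (α * a - β * b) ^ 2 ≤ ((a + b) ^ 2 * |a - b| / 6) ^ 2 := by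
      rw [hαa, hβb, ← sq_abs ((a - Real.sin a) - (b - Real.sin b))]
      exact pow_le_pow_left₀ (abs_nonneg _) (abs_sub_sin_sub_le ha0 hv hb0 hw) 2
    have h2 : ((a + b) ^ 2 * |a - b| / 6) ^ 2 = (a + b) ^ 2 * ((a + b) ^ 2 * (a - b) ^ 2) / 36 := by
      rw [div_pow, mul_pow, sq_abs]; ring
    have h4 : (a + b) ^ 2 ≤ 4 := by
      have hab2 : a + b ≤ 2 := by linarith
      have := pow_le_pow_left₀ (add_nonneg ha0 hb0) hab2 2
      linarith [this, show (2 : ℝ) ^ 2 = 4 by norm_num]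
    have h0 : 0 ≤ (a + b) ^ 2 * (a - b) ^ 2 := by positivity
    have h3 : (a + b) ^ 2 * ((a + b) ^ 2 * (a - b) ^ 2) ≤ 4 * ((a + b) ^ 2 * (a - b) ^ 2) :=
      mul_le_mul_of_nonneg_right h4 h0
    rw [h2] at h1
    linarith
  have hmono : 2 * (α * β) * (a * b - inner ℝ v w) ≤ 2 * (a + b) ^ 2 * (a * b - inner ℝ v w) := by
    have := mul_le_mul_of_nonneg_right hαβ (sub_nonneg.mpr ht)
    linarith
  have key : ‖(exp (imQuat v) - imQuat v) - (exp (imQuat w) - imQuat w)‖ ^ 2 ≤ ((a + b) * ‖v - w‖) ^ 2 := by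
    rw [hD, hR]
    have h0 : 0 ≤ (a + b) ^ 2 * (a - b) ^ 2 := by positivity
    linarith
  have hnn : 0 ≤ (a + b) * ‖v - w‖ := mul_nonneg (add_nonneg ha0 hb0) (norm_nonneg _)
  exact (pow_le_pow_iff_left₀ (norm_nonneg _) hnn two_ne_zero).mp key


/-! ## §3 The relative four-factor expansion -/

/-- ★ **TWO FACTORS, RELATIVE**: `x₁x₂ − y₁y₂ − (ℓ₁ + ℓ₂) = (x₁ − y₁ − ℓ₁)x₂ + ℓ₁(x₂ − 1) + y₁(x₂ − y₂ − ℓ₂) + (y₁ − 1)ℓ₂`, hence for factors of norm `≤ 1`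
the linearisation error of a product is the sum of the factors' errors plus SIZE × LINEAR-PART cross terms. [folklore] -/
theorem norm_mul_sub_mul_sub_add_le {A : Type*} [NormedRing A] {x₁ x₂ y₁ y₂ ℓ₁ ℓ₂ : A} {ρ₁ ρ₂ lam₁ lam₂ σ₂ σ₁' : ℝ}
    (hx₂ : ‖x₂‖ ≤ 1) (hy₁ : ‖y₁‖ ≤ 1) (h₁ : ‖x₁ - y₁ - ℓ₁‖ ≤ ρ₁) (h₂ : ‖x₂ - y₂ - ℓ₂‖ ≤ ρ₂) (hl₁ : ‖ℓ₁‖ ≤ lam₁) (hl₂ : ‖ℓ₂‖ ≤ lam₂)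
    (hs₂ : ‖x₂ - 1‖ ≤ σ₂) (hs₁ : ‖y₁ - 1‖ ≤ σ₁') :
    ‖x₁ * x₂ - y₁ * y₂ - (ℓ₁ + ℓ₂)‖ ≤ ρ₁ + ρ₂ + lam₁ * σ₂ + σ₁' * lam₂ := by
  have hρ₁ : 0 ≤ ρ₁ := (norm_nonneg _).trans h₁
  have hρ₂ : 0 ≤ ρ₂ := (norm_nonneg _).trans h₂
  have hl₁0 : 0 ≤ lam₁ := (norm_nonneg _).trans hl₁
  have hσ₁0 : 0 ≤ σ₁' := (norm_nonneg _).trans hs₁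
  have e : x₁ * x₂ - y₁ * y₂ - (ℓ₁ + ℓ₂) = (x₁ - y₁ - ℓ₁) * x₂ + ℓ₁ * (x₂ - 1) + y₁ * (x₂ - y₂ - ℓ₂) + (y₁ - 1) * ℓ₂ := by
    noncomm_ring
  rw [e]
  have t1 : ‖(x₁ - y₁ - ℓ₁) * x₂‖ ≤ ρ₁ :=
    (norm_mul_le _ _).trans (by nlinarith [norm_nonneg (x₁ - y₁ - ℓ₁), norm_nonneg x₂])
  have t2 : ‖ℓ₁ * (x₂ - 1)‖ ≤ lam₁ * σ₂ := (norm_mul_le _ _).trans (mul_le_mul hl₁ hs₂ (norm_nonneg _) hl₁0)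
  have t3 : ‖y₁ * (x₂ - y₂ - ℓ₂)‖ ≤ ρ₂ :=
    (norm_mul_le _ _).trans (by nlinarith [norm_nonneg (x₂ - y₂ - ℓ₂), norm_nonneg y₁])
  have t4 : ‖(y₁ - 1) * ℓ₂‖ ≤ σ₁' * lam₂ := (norm_mul_le _ _).trans (mul_le_mul hs₁ hl₂ (norm_nonneg _) hσ₁0)
  have s1 := norm_add_le ((x₁ - y₁ - ℓ₁) * x₂ + ℓ₁ * (x₂ - 1) + y₁ * (x₂ - y₂ - ℓ₂)) ((y₁ - 1) * ℓ₂)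
  have s2 := norm_add_le ((x₁ - y₁ - ℓ₁) * x₂ + ℓ₁ * (x₂ - 1)) (y₁ * (x₂ - y₂ - ℓ₂))
  have s3 := norm_add_le ((x₁ - y₁ - ℓ₁) * x₂) (ℓ₁ * (x₂ - 1))
  linarith

/-- Bookkeeping for the recursion: `‖x₁x₂‖ ≤ 1` and `‖x₁x₂ − 1‖ ≤ σ₁ + σ₂` for factors of norm `≤ 1`. [folklore] -/
theorem norm_mul_le_one_and {A : Type*} [NormedRing A] {x₁ x₂ : A} {σ₁ σ₂ : ℝ} (hx₁ : ‖x₁‖ ≤ 1) (hx₂ : ‖x₂‖ ≤ 1)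
    (hs₁ : ‖x₁ - 1‖ ≤ σ₁) (hs₂ : ‖x₂ - 1‖ ≤ σ₂) : ‖x₁ * x₂‖ ≤ 1 ∧ ‖x₁ * x₂ - 1‖ ≤ σ₁ + σ₂ := by
  refine ⟨(norm_mul_le _ _).trans (by nlinarith [norm_nonneg x₁, norm_nonneg x₂]), ?_⟩
  have e : x₁ * x₂ - 1 = (x₁ - 1) * x₂ + (x₂ - 1) := by noncomm_ring
  rw [e]
  refine (norm_add_le _ _).trans (add_le_add ((norm_mul_le _ _).trans ?_) hs₂)
  nlinarith [norm_nonneg (x₁ - 1), norm_nonneg x₂, (norm_nonneg _).trans hs₁]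

/-- One exponential factor against another: norm `1`, chord `≤ ‖v‖`, linear part `ι(v − ṽ)` of norm `‖v − ṽ‖`, and the relative remainder
`‖e^{ιv} − e^{ιṽ} − ι(v − ṽ)‖ ≤ (‖v‖ + ‖ṽ‖)·‖v − ṽ‖` (§2). [folklore] -/
theorem expFactor_rel {v v' : EuclideanSpace ℝ (Fin 3)} {τ τ' : ℝ} (hv : ‖v‖ ≤ τ) (hv' : ‖v'‖ ≤ τ') (hτ : τ ≤ 1) (hτ' : τ' ≤ 1) :
    ‖exp (imQuat v)‖ ≤ 1 ∧ ‖exp (imQuat v')‖ ≤ 1 ∧ ‖exp (imQuat v) - 1‖ ≤ τ ∧ ‖exp (imQuat v') - 1‖ ≤ τ' ∧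
      ‖imQuat (v - v')‖ ≤ ‖v - v'‖ ∧ ‖exp (imQuat v) - exp (imQuat v') - imQuat (v - v')‖ ≤ (τ + τ') * ‖v - v'‖ := by
  refine ⟨(norm_exp_imQuat v).le, (norm_exp_imQuat v').le, (norm_exp_imQuat_sub_one_le v).trans hv,
    (norm_exp_imQuat_sub_one_le v').trans hv', (norm_imQuat _).le, ?_⟩
  have e : exp (imQuat v) - exp (imQuat v') - imQuat (v - v') = (exp (imQuat v) - imQuat v) - (exp (imQuat v') - imQuat v') := by
    rw [map_sub]; abel
  rw [e]
  exact (norm_expRem_sub_expRem_le (hv.trans hτ) (hv'.trans hτ')).trans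
    (mul_le_mul_of_nonneg_right (add_le_add hv hv') (norm_nonneg _))

/-- ★★ **THE RELATIVE FOUR-FACTOR EXPANSION**: for `‖a‖, ‖b‖, ‖c‖, ‖d‖ ≤ τ ≤ 1∕4` and `‖ã‖, ‖b̃‖, ‖c̃‖, ‖d̃‖ ≤ τ̃ ≤ 1∕4`,
`‖q(e^a e^b (e^c)⁻¹ (e^d)⁻¹) − q(e^ã e^b̃ (e^c̃)⁻¹ (e^d̃)⁻¹) − ι((a + b − c − d) − (ã + b̃ − c̃ − d̃))‖ ≤ 4·(τ + τ̃)·(‖a − ã‖ + ‖b − b̃‖ + ‖c − c̃‖ + ‖d − d̃‖)`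
(`q = su2Quat`, `e^x = expPoint x`): the two plaquette words differ by the LINEARISED CURL OF THE DIFFERENCE up to SIZE × DIFFERENCE. [cite: Balaban1985Variational, (34) p.283] -/
theorem norm_plaq4_sub_plaq4_sub_le {a b c d a' b' c' d' : EuclideanSpace ℝ (Fin 3)} {τ τ' : ℝ}
    (ha : ‖a‖ ≤ τ) (hb : ‖b‖ ≤ τ) (hc : ‖c‖ ≤ τ) (hd : ‖d‖ ≤ τ) (ha' : ‖a'‖ ≤ τ') (hb' : ‖b'‖ ≤ τ') (hc' : ‖c'‖ ≤ τ') (hd' : ‖d'‖ ≤ τ')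
    (hτ : τ ≤ 1 / 4) (hτ' : τ' ≤ 1 / 4) :
    ‖su2Quat (expPoint a * expPoint b * (expPoint c)⁻¹ * (expPoint d)⁻¹)
        - su2Quat (expPoint a' * expPoint b' * (expPoint c')⁻¹ * (expPoint d')⁻¹)
        - imQuat ((a + b - c - d) - (a' + b' - c' - d'))‖
      ≤ 4 * (τ + τ') * (‖a - a'‖ + ‖b - b'‖ + ‖c - c'‖ + ‖d - d'‖) := by
  have hτ0 : 0 ≤ τ := (norm_nonneg _).trans ha
  have hτ0' : 0 ≤ τ' := (norm_nonneg _).trans ha'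
  have hτ1 : τ ≤ 1 := by linarith
  have hτ1' : τ' ≤ 1 := by linarith
  -- `expPoint (−x) = (expPoint x)⁻¹` (= ✓`OrganTangentAnchorFreeOscillation.expPoint_neg`; two lines, restated inline to keep imports light)
  have expPoint_neg : ∀ x : EuclideanSpace ℝ (Fin 3), expPoint (-x) = (expPoint x)⁻¹ := fun x => by
    have h := FluctuationComparisonRegPrIntLS2BetaDistributedHolonomySU2.expPoint_add_smul x 1 (-1)
    rw [add_neg_cancel, zero_smul, T4HaarSU2ExpChart.expPoint_zero, one_smul, neg_one_smul] at h
    exact (eq_inv_of_mul_eq_one_right h.symm)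
  have hι : imQuat ((a + b - c - d) - (a' + b' - c' - d'))
      = imQuat (a - a') + imQuat (b - b') + imQuat (-c - -c') + imQuat (-d - -d') := by
    simp only [map_sub, map_add, map_neg]; abel
  rw [← expPoint_neg c, ← expPoint_neg d, ← expPoint_neg c', ← expPoint_neg d', su2Quat_mul, su2Quat_mul, su2Quat_mul,
    su2Quat_mul, su2Quat_mul, su2Quat_mul, su2Quat_expPoint, su2Quat_expPoint, su2Quat_expPoint, su2Quat_expPoint,
    su2Quat_expPoint, su2Quat_expPoint, su2Quat_expPoint, su2Quat_expPoint, hι]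
  have hnc : ‖-c‖ ≤ τ := by rwa [norm_neg]
  have hnd : ‖-d‖ ≤ τ := by rwa [norm_neg]
  have hnc' : ‖-c'‖ ≤ τ' := by rwa [norm_neg]
  have hnd' : ‖-d'‖ ≤ τ' := by rwa [norm_neg]
  obtain ⟨x1, y1, s1, s1', l1, r1⟩ := expFactor_rel ha ha' hτ1 hτ1'
  obtain ⟨x2, y2, s2, s2', l2, r2⟩ := expFactor_rel hb hb' hτ1 hτ1'
  obtain ⟨x3, y3, s3, s3', l3, r3⟩ := expFactor_rel hnc hnc' hτ1 hτ1'
  obtain ⟨x4, y4, s4, s4', l4, r4⟩ := expFactor_rel hnd hnd' hτ1 hτ1'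
  -- two, three, four factors
  have h12 := norm_mul_sub_mul_sub_add_le x2 y1 r1 r2 l1 l2 s2 s1'
  obtain ⟨x12, s12⟩ := norm_mul_le_one_and x1 x2 s1 s2
  obtain ⟨y12, s12'⟩ := norm_mul_le_one_and y1 y2 s1' s2'
  have l12 : ‖imQuat (a - a') + imQuat (b - b')‖ ≤ ‖a - a'‖ + ‖b - b'‖ := (norm_add_le _ _).trans (add_le_add l1 l2)
  have h123 := norm_mul_sub_mul_sub_add_le x3 y12 h12 r3 l12 l3 s3 s12'
  obtain ⟨x123, s123⟩ := norm_mul_le_one_and x12 x3 s12 s3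
  obtain ⟨y123, -⟩ := norm_mul_le_one_and y12 y3 s12' s3'
  have s123' : ‖exp (imQuat a') * exp (imQuat b') * exp (imQuat (-c')) - 1‖ ≤ τ' + τ' + τ' :=
    (norm_mul_le_one_and y12 y3 s12' s3').2
  have l123 : ‖imQuat (a - a') + imQuat (b - b') + imQuat (-c - -c')‖ ≤ ‖a - a'‖ + ‖b - b'‖ + ‖c - c'‖ := by
    refine (norm_add_le _ _).trans (add_le_add l12 (l3.trans (le_of_eq ?_)))
    rw [show -c - -c' = -(c - c') by abel, norm_neg]
  have h1234 := norm_mul_sub_mul_sub_add_le x4 y123 h123 r4 l123 l4 s4 s123'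
  have hδc : ‖-c - -c'‖ = ‖c - c'‖ := by rw [show -c - -c' = -(c - c') by abel, norm_neg]
  have hδd : ‖-d - -d'‖ = ‖d - d'‖ := by rw [show -d - -d' = -(d - d') by abel, norm_neg]
  rw [hδc, hδd] at h1234
  refine h1234.trans ?_
  -- collect: `(τ+τ̃)Σδ + τ(3δ_a + 2δ_b + δ_c) + τ̃(δ_b + 2δ_c + 3δ_d) ≤ 4(τ+τ̃)Σδ`
  have pa := mul_nonneg hτ0 (norm_nonneg (a - a')); have pa' := mul_nonneg hτ0' (norm_nonneg (a - a'))
  have pb := mul_nonneg hτ0 (norm_nonneg (b - b')); have pb' := mul_nonneg hτ0' (norm_nonneg (b - b'))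
  have pc := mul_nonneg hτ0 (norm_nonneg (c - c')); have pc' := mul_nonneg hτ0' (norm_nonneg (c - c'))
  have pd := mul_nonneg hτ0 (norm_nonneg (d - d')); have pd' := mul_nonneg hτ0' (norm_nonneg (d - d'))
  linarith [pa, pa', pb, pb', pc, pc', pd, pd']

/-- `dist1 (B⁻¹·A) = ‖q A − q B‖` on `SU(2)` (left-invariance of the chord). [folklore] -/
theorem dist1_inv_mul_eq_norm_sub (A B : SU2) : dist1 (B⁻¹ * A) = ‖su2Quat A - su2Quat B‖ := by
  rw [dist1_eq_norm_su2Quat_sub_one, su2Quat_mul]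
  have hB : su2Quat B⁻¹ * su2Quat B = 1 := by rw [← su2Quat_mul, inv_mul_cancel, su2Quat_one]
  have e : su2Quat B⁻¹ * su2Quat A - 1 = su2Quat B⁻¹ * (su2Quat A - su2Quat B) := by rw [mul_sub, hB]
  rw [e, norm_mul, norm_su2Quat, one_mul]

/-- ★★ **THE RELATIVE PLAQUETTE TO FIRST ORDER IN THE DIFFERENCE**: with `E := (e^ã e^b̃ (e^c̃)⁻¹ (e^d̃)⁻¹)⁻¹ · (e^a e^b (e^c)⁻¹ (e^d)⁻¹)`
(the orientation `(plaqHol U₀ p)⁻¹ * plaqHol U p` of ✓`…S2BetaExcessSplit`), `dist1 E ≤ ‖(a + b − c − d) − (ã + b̃ − c̃ − d̃)‖ + 4(τ + τ̃)·Σδ`. [cite: Balaban1985Variational, (34) p.283] -/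
theorem dist1_plaq4_rel_le {a b c d a' b' c' d' : EuclideanSpace ℝ (Fin 3)} {τ τ' : ℝ}
    (ha : ‖a‖ ≤ τ) (hb : ‖b‖ ≤ τ) (hc : ‖c‖ ≤ τ) (hd : ‖d‖ ≤ τ) (ha' : ‖a'‖ ≤ τ') (hb' : ‖b'‖ ≤ τ') (hc' : ‖c'‖ ≤ τ') (hd' : ‖d'‖ ≤ τ')
    (hτ : τ ≤ 1 / 4) (hτ' : τ' ≤ 1 / 4) :
    dist1 ((expPoint a' * expPoint b' * (expPoint c')⁻¹ * (expPoint d')⁻¹)⁻¹ * (expPoint a * expPoint b * (expPoint c)⁻¹ * (expPoint d)⁻¹))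
      ≤ ‖(a + b - c - d) - (a' + b' - c' - d')‖ + 4 * (τ + τ') * (‖a - a'‖ + ‖b - b'‖ + ‖c - c'‖ + ‖d - d'‖) := by
  have h := norm_plaq4_sub_plaq4_sub_le ha hb hc hd ha' hb' hc' hd' hτ hτ'
  rw [dist1_inv_mul_eq_norm_sub]
  calc ‖su2Quat (expPoint a * expPoint b * (expPoint c)⁻¹ * (expPoint d)⁻¹) - su2Quat (expPoint a' * expPoint b' * (expPoint c')⁻¹ * (expPoint d')⁻¹)‖
      = ‖(su2Quat (expPoint a * expPoint b * (expPoint c)⁻¹ * (expPoint d)⁻¹) - su2Quat (expPoint a' * expPoint b' * (expPoint c')⁻¹ * (expPoint d')⁻¹)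
          - imQuat ((a + b - c - d) - (a' + b' - c' - d'))) + imQuat ((a + b - c - d) - (a' + b' - c' - d'))‖ := by rw [sub_add_cancel]
    _ ≤ _ := norm_add_le _ _
    _ ≤ _ := by rw [norm_imQuat]; linarith

/-- … and conversely the linearised curl of the difference is bounded by the relative chord plus the same remainder. [cite: Balaban1985Variational, (34) p.283] -/
theorem norm_lincurl_sub_le_dist1_rel_add {a b c d a' b' c' d' : EuclideanSpace ℝ (Fin 3)} {τ τ' : ℝ}
    (ha : ‖a‖ ≤ τ) (hb : ‖b‖ ≤ τ) (hc : ‖c‖ ≤ τ) (hd : ‖d‖ ≤ τ) (ha' : ‖a'‖ ≤ τ') (hb' : ‖b'‖ ≤ τ') (hc' : ‖c'‖ ≤ τ') (hd' : ‖d'‖ ≤ τ')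
    (hτ : τ ≤ 1 / 4) (hτ' : τ' ≤ 1 / 4) :
    ‖(a + b - c - d) - (a' + b' - c' - d')‖
      ≤ dist1 ((expPoint a' * expPoint b' * (expPoint c')⁻¹ * (expPoint d')⁻¹)⁻¹ * (expPoint a * expPoint b * (expPoint c)⁻¹ * (expPoint d)⁻¹))
        + 4 * (τ + τ') * (‖a - a'‖ + ‖b - b'‖ + ‖c - c'‖ + ‖d - d'‖) := by
  have h := norm_plaq4_sub_plaq4_sub_le ha hb hc hd ha' hb' hc' hd' hτ hτ'
  rw [dist1_inv_mul_eq_norm_sub, ← norm_imQuat ((a + b - c - d) - (a' + b' - c' - d'))]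
  calc ‖imQuat ((a + b - c - d) - (a' + b' - c' - d'))‖
      = ‖(su2Quat (expPoint a * expPoint b * (expPoint c)⁻¹ * (expPoint d)⁻¹) - su2Quat (expPoint a' * expPoint b' * (expPoint c')⁻¹ * (expPoint d')⁻¹))
          - ((su2Quat (expPoint a * expPoint b * (expPoint c)⁻¹ * (expPoint d)⁻¹) - su2Quat (expPoint a' * expPoint b' * (expPoint c')⁻¹ * (expPoint d')⁻¹))
              - imQuat ((a + b - c - d) - (a' + b' - c' - d')))‖ := by rw [sub_sub_cancel]
    _ ≤ _ := norm_sub_le _ _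
    _ ≤ _ := by linarith

/-- ZEROTH ORDER (no curl structure, no smallness): `dist1 E ≤ ‖a − ã‖ + ‖b − b̃‖ + ‖c − c̃‖ + ‖d − d̃‖` — telescoping with §1 of ✓`…WhitneyHatLiftRelative`
(`‖e^{ιv} − e^{ιw}‖ ≤ ‖v − w‖`, unit factors). [folklore] -/
theorem dist1_plaq4_rel_le_sum (a b c d a' b' c' d' : EuclideanSpace ℝ (Fin 3)) :
    dist1 ((expPoint a' * expPoint b' * (expPoint c')⁻¹ * (expPoint d')⁻¹)⁻¹ * (expPoint a * expPoint b * (expPoint c)⁻¹ * (expPoint d)⁻¹))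
      ≤ ‖a - a'‖ + ‖b - b'‖ + ‖c - c'‖ + ‖d - d'‖ := by
  have expPoint_neg : ∀ x : EuclideanSpace ℝ (Fin 3), expPoint (-x) = (expPoint x)⁻¹ := fun x => by
    have h := FluctuationComparisonRegPrIntLS2BetaDistributedHolonomySU2.expPoint_add_smul x 1 (-1)
    rw [add_neg_cancel, zero_smul, T4HaarSU2ExpChart.expPoint_zero, one_smul, neg_one_smul] at h
    exact (eq_inv_of_mul_eq_one_right h.symm)
  rw [dist1_inv_mul_eq_norm_sub, ← expPoint_neg c, ← expPoint_neg d, ← expPoint_neg c', ← expPoint_neg d', su2Quat_mul, su2Quat_mul,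
    su2Quat_mul, su2Quat_mul, su2Quat_mul, su2Quat_mul, su2Quat_expPoint, su2Quat_expPoint, su2Quat_expPoint, su2Quat_expPoint,
    su2Quat_expPoint, su2Quat_expPoint, su2Quat_expPoint, su2Quat_expPoint]
  -- telescoping `x₁x₂x₃x₄ − y₁y₂y₃y₄` with unit factors
  have tele : ∀ (x y X Y : ℍ), ‖x‖ ≤ 1 → ‖Y‖ ≤ 1 → ‖X * x - Y * y‖ ≤ ‖X - Y‖ + ‖x - y‖ := by
    intro x y X Y hx hY
    have e : X * x - Y * y = (X - Y) * x + Y * (x - y) := by noncomm_ring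
    rw [e]
    refine (norm_add_le _ _).trans (add_le_add ((norm_mul_le _ _).trans ?_) ((norm_mul_le _ _).trans ?_))
    · nlinarith [norm_nonneg (X - Y), norm_nonneg x]
    · nlinarith [norm_nonneg (x - y), norm_nonneg Y]
  have u : ∀ v : EuclideanSpace ℝ (Fin 3), ‖exp (imQuat v)‖ ≤ 1 := fun v => (norm_exp_imQuat v).le
  have u2 : ‖exp (imQuat a') * exp (imQuat b')‖ ≤ 1 := (norm_mul_le _ _).trans (by nlinarith [u a', u b', norm_nonneg (exp (imQuat a'))])
  have u3 : ‖exp (imQuat a') * exp (imQuat b') * exp (imQuat (-c'))‖ ≤ 1 :=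
    (norm_mul_le _ _).trans (by nlinarith [u2, u (-c'), norm_nonneg (exp (imQuat (-c')))])
  have E1 := norm_exp_imQuat_sub_exp_imQuat_le_norm_sub
  calc _ ≤ ‖exp (imQuat a) * exp (imQuat b) * exp (imQuat (-c)) - exp (imQuat a') * exp (imQuat b') * exp (imQuat (-c'))‖
          + ‖exp (imQuat (-d)) - exp (imQuat (-d'))‖ := tele _ _ _ _ (u _) u3
    _ ≤ (‖exp (imQuat a) * exp (imQuat b) - exp (imQuat a') * exp (imQuat b')‖ + ‖exp (imQuat (-c)) - exp (imQuat (-c'))‖)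
          + ‖exp (imQuat (-d)) - exp (imQuat (-d'))‖ := by gcongr; exact tele _ _ _ _ (u _) u2
    _ ≤ ((‖exp (imQuat a) - exp (imQuat a')‖ + ‖exp (imQuat b) - exp (imQuat b')‖) + ‖exp (imQuat (-c)) - exp (imQuat (-c'))‖)
          + ‖exp (imQuat (-d)) - exp (imQuat (-d'))‖ := by
        gcongr
        simpa using tele (exp (imQuat b)) (exp (imQuat b')) (exp (imQuat a)) (exp (imQuat a')) (u _) (u _)
    _ ≤ ((‖a - a'‖ + ‖b - b'‖) + ‖-c - -c'‖) + ‖-d - -d'‖ := by gcongr <;> exact E1 _ _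
    _ = _ := by rw [show -c - -c' = -(c - c') by abel, show -d - -d' = -(d - d') by abel, norm_neg, norm_neg]

end Summit.QuantumFields.YangMills.Theorems.FluctuationComparisonRegPrIntLS2BetaSU2FourFactorRelative

end
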